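/-
Copyright (c) 2026 the pub-hodgecm-mathlib formalisation cell (harness21).  Prover seat hodgecm-mathlib-K2E4-p10 (g4), Track B ∕ K2-LIT, h413 =
`stmt-HodgeConjecture-24833`, line `K2_E1_TraceFormulaBeta`, campaign «EIS-RANK-ONE» rung R6g-LITE; DEAL [D4] «EIS-R6g-LITE» of the dealer K2E1-plan (g3)
2026-09-04T06:00:20Z ∕ 06:06:06Z, the `_two` twin: the flat-section Maass–Selberg relation of `U(J₂)` on BOTH off-diagonal sub-tubes (`2ρ = 1`).
-/
import Summits.HodgeConjecture.HodgeConjecture.Theorems.K2E1MaassSelbergSymmetry        -- ★ p857832 (this seat): §1 Hermitian swap, §2 transport (`2ρ = 2`), `U(J₃)` pair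
import Summits.HodgeConjecture.HodgeConjecture.Theorems.K2E1MaassSelbergCMTwo           -- ★ p857759 (K2E4-p14 g5): `maassSelberg_flatSectionU_two_adj` (concrete `M, M′`)
import HarnessLib

/-!
# K2·E1 — `K2E1MaassSelbergSymmetryTwo`: THE MAASS–SELBERG RELATION OF `U(J₂)` ON BOTH SUB-TUBES `{1 < Re z′ < Re z}` AND `{1 < Re z < Re z′}`
# (campaign «EIS-RANK-ONE», rung R6g-LITE, the `N = 2` twin of ★ p857832: `2ρ = 1`, exponents `s₁ = z + conj z′ − 1`, `s₂ = z − conj z′`)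

Track B ∕ K2-LIT, crux h413 = `stmt-HodgeConjecture-24833`, route of record `HCCMUnconditional`; cell `hodgecm-mathlib`, squad K2, ENGINE E1.  Prover seat
`hodgecm-mathlib-K2E4-p10` (g4); DEAL [D4] of the dealer K2E1-plan (g3) 2026-09-04T06:00:20Z ∕ 06:06:06Z («`_two` over p857759 if < 400 l.» — delivered as its own file).
THEOREMS ONLY (no `def`, no `instance`, no notation, no named-fact hypothesis, no `sorry`); lane `--supports stmt-HodgeConjecture-24833 --as helper` (count-neutral).  Closes no socket.

THE MATHEMATICS [MoeglinWaldspurger1995, IV.2.1–IV.2.3; Arthur1980TraceFormulaII, §4; Garrett2018, §11.3].  As in ★ `K2E1MaassSelbergSymmetry` with `2ρ = 1` (`U(1,1)`): §1 the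
transport lemma with the exponents `z′ + conj z − 1 ↦ s₁ = z + conj z′ − 1` (invariant) and `z′ − conj z ↦ −s₂` (★ `conj_sub_conj`), `conj T^s = T^{conj s}` (★ `conj_ofReal_cpow`);
§2 `maassSelberg_truncation_pair_two`: ONE pair of constants `(c_μ, K)` from ★ `maassSelberg_flatSectionU_two_adj`, the coefficients and the four `K_U`-averages `Ξ₁…Ξ₄` bound once
in the original convention, and the relation `⟨Λ^T E(φ,z), Λ^T E(φ′,z′)⟩_X = c_μ·K·((T^{s₁}∕s₁)[Ξ₁] + (T^{s₂}∕s₂)[Ξ₂] − (T^{−s₂}∕s₂)[Ξ₃] − (T^{−s₁}∕s₁)[Ξ₄])` (A) on `1 < Re z′ < Re z`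
under ★ `_two_adj`'s named inputs with `Λ′ := Λ^T E(φ′,z′)` and (B) on `1 < Re z < Re z′` under the mirror inputs (★ `_two_adj` at the swapped data with
`Ξ′ = (conj Ξ₁, conj Ξ₃, conj Ξ₂, conj Ξ₄)`, then ★ `integral_mul_conj_symm` + §1).  The diagonal `Re z = Re z′` is NOT claimed.
HONEST LABEL: HC_CM is proved only modulo the 7 printed citations (2 remaining named inputs: hLiu418 = `stmt-HodgeConjecture-24832`, h413 = `stmt-HodgeConjecture-24833`) until rung 0
closes; this file asserts no named fact and closes no socket.
References: [MoeglinWaldspurger1995] IV.2.1–IV.2.3 · [Arthur1980TraceFormulaII] §4 · [Garrett2018] §11.3.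
-/

set_option autoImplicit false
-- the mandated namespace repeats the single-problem summit's segment (`HodgeConjecture.HodgeConjecture`)
set_option linter.dupNamespace false

noncomputable section

open MeasureTheory Measure NumberField IsDedekindDomain Set MulAction
open scoped ENNReal NNReal ComplexConjugate
open Literature.MeasureTheory.Group Literature.NumberTheory
open Literature.NumberTheory.Automorphic Literature.NumberTheory.Automorphic.UnitaryGroup AdelicGroupData
open Summit.HodgeConjecture.HodgeConjecture.Cruxes.H413.K2E1BorelEisensteinU
open Summit.HodgeConjecture.HodgeConjecture.Cruxes.H413.K2E1IdeleClassMellinWeighted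
open Summit.HodgeConjecture.HodgeConjecture.Cruxes.H413.K2E1TorusHeightMellin
open Summit.HodgeConjecture.HodgeConjecture.Cruxes.H413.K2E1MaassSelbergCMTwo
open Summit.HodgeConjecture.HodgeConjecture.Cruxes.H413.K2E1MaassSelbergSymmetry
open Literature.NumberTheory.EllipticCurves.ModularForms (conj_ofReal_cpow)

namespace Summit.HodgeConjecture.HodgeConjecture.Cruxes.H413.K2E1MaassSelbergSymmetryTwo

/-! ## §1 The transport across the diagonal for `2ρ = 1` -/

section Transport

/-- `s₁` is invariant under the swap (`2ρ = 1`): `conj (z′ + conj z − 1) = z + conj z′ − 1`. [folklore] -/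
theorem conj_add_conj_sub_one (z z' : ℂ) : conj (z' + conj z - 1) = z + conj z' - 1 := by
  rw [map_sub, map_add, Complex.conj_conj, map_one]; ring

variable {X : Type*} [MeasurableSpace X]

/-- **HYPOTHESIS-FIRST TRANSPORT ACROSS THE DIAGONAL, `2ρ = 1`.**  If `∫ B·conj A` satisfies a relation of Maass–Selberg shape in the exponents of the SWAPPED pair
(`z′ + conj z − 1`, `z′ − conj z`) with brackets `J₁, J₂, J₃, J₄`, then `∫ A·conj B` satisfies it in `s₁ = z + conj z′ − 1`, `s₂ = z − conj z′` with the brackets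
`conj J₁, conj J₃, conj J₂, conj J₄` (★ `integral_mul_conj_symm`, `conj (z′ + conj z − 1) = s₁`, ★ `conj_sub_conj`, ★ `conj_ofReal_cpow`).  Pure algebra.
[cite: MoeglinWaldspurger1995, IV.2.3] [cite: Arthur1980TraceFormulaII, §4] -/
theorem maassSelberg_transport_of_swap_one (μ : Measure X) {A B : X → ℂ} {T : ℝ} (hT : 0 ≤ T) {cμ K : ℝ} {z z' : ℂ} {J₁ J₂ J₃ J₄ : ℂ}
    (h : ∫ x, B x * conj (A x) ∂μ =
      (cμ : ℂ) * ((K : ℂ) *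
        (((T : ℂ) ^ (z' + conj z - 1) / (z' + conj z - 1)) * J₁ + ((T : ℂ) ^ (z' - conj z) / (z' - conj z)) * J₂
          - ((T : ℂ) ^ (-(z' - conj z)) / (z' - conj z)) * J₃ - ((T : ℂ) ^ (-(z' + conj z - 1)) / (z' + conj z - 1)) * J₄))) :
    ∫ x, A x * conj (B x) ∂μ =
      (cμ : ℂ) * ((K : ℂ) *
        (((T : ℂ) ^ (z + conj z' - 1) / (z + conj z' - 1)) * conj J₁ + ((T : ℂ) ^ (z - conj z') / (z - conj z')) * conj J₃
          - ((T : ℂ) ^ (-(z - conj z')) / (z - conj z')) * conj J₂ - ((T : ℂ) ^ (-(z + conj z' - 1)) / (z + conj z' - 1)) * conj J₄)) := by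
  rw [integral_mul_conj_symm μ A B, h]
  -- open the conjugate down to the four coefficients (outermost first), then the exponents all at once
  rw [map_mul, map_mul, map_sub, map_sub, map_add, map_mul, map_mul, map_mul, map_mul, map_div₀, map_div₀, map_div₀, map_div₀,
    conj_ofReal_cpow hT, conj_ofReal_cpow hT, conj_ofReal_cpow hT, conj_ofReal_cpow hT, map_neg, map_neg, conj_add_conj_sub_one, conj_sub_conj, neg_neg,
    Complex.conj_ofReal, Complex.conj_ofReal, div_neg, div_neg]
  ring

end Transport

/-! ## §2 `U(J₂)`: the relation for the truncated pair `(Λ^T E(φ,z), Λ^T E(φ′,z′))` on BOTH off-diagonal sub-tubes, one pair of constants -/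

section Pair

variable {F E : Type} [Field F] [NumberField F] [Field E] [NumberField E] [Algebra F E] {c : E ≃ₐ[F] E}
variable [MeasurableSpace (quasiSplit F E c 2).Adelic] [BorelSpace (quasiSplit F E c 2).Adelic]
variable [MeasurableSpace (AdeleRing (𝓞 E) E)ˣ] [BorelSpace (AdeleRing (𝓞 E) E)ˣ]

/-- **THE MAASS–SELBERG RELATION FOR THE TRUNCATED PAIR `(Λ^T E(φ,z), Λ^T E(φ′,z′))` OF `U(J₂)` ON THE WHOLE OFF-DIAGONAL TUBE** (generic quadratic `E/F`, `c² = 1`, `c ≠ 1`, `2ρ = 1`; concrete intertwining operators `M h (g) = ∫_{N(𝔸)} h(w₀·u·g) dν`, `M′` with `w₀⁻¹`, as ★ `maassSelberg_flatSectionU_two_adj`).  ONE pair of constants `(c_μ, K)` serves both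
sub-tubes; the coefficients `φ, φ′, φ̃, φ̃′` and the four `K_U`-averages `Ξ₁…Ξ₄` (of `φ·conj φ′`, `φ·conj φ̃′`, `φ̃·conj φ′`, `φ̃·conj φ̃′`) are bound ONCE in the original convention; then
(A) on `1 < Re z′ < Re z`, under ★ `_adj`'s named inputs with `Λ′ := Λ^T E(φ′,z′)` (constant term of `E(f_z)`, summability of `f_z`, `Λ^T E(φ′,z′)` Borel ∕ `G(F)`-invariant ∕ bounded,
the weighted `L¹`-ness of `ψ = 𝟙_{H≤T} f_z − 𝟙_{T<H} φ̃_{1−z}`, the two-piece constant term of `Λ^T E(φ′,z′)`, `M′ψ = φ̃_{1−z}` high in the cusp, `hi₅`, `habs`, `habs′`), and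
(B) on `1 < Re z < Re z′`, under the MIRROR named inputs (the same list for the swapped pair), the SAME relation holds:
`⟨Λ^T E(φ,z), Λ^T E(φ′,z′)⟩_X = c_μ·K·((T^{s₁}∕s₁)[Ξ₁] + (T^{s₂}∕s₂)[Ξ₂] − (T^{−s₂}∕s₂)[Ξ₃] − (T^{−s₁}∕s₁)[Ξ₄])`, `s₁ = z + conj z′ − 1`, `s₂ = z − conj z′`.  (B) is ★ `_adj` at the swapped
data with `Ξ′ := (conj Ξ₁, conj Ξ₃, conj Ξ₂, conj Ξ₄)`, transported by §1 `maassSelberg_transport_of_swap_one`.  The diagonal is not claimed.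
[cite: MoeglinWaldspurger1995, IV.2.1–IV.2.3] [cite: Arthur1980TraceFormulaII, §4] [cite: Garrett2018, §11.3] -/
theorem maassSelberg_truncation_pair_two (hc : c * c = 1) (hc1 : c ≠ 1)
    (μ : Measure (quasiSplit F E c 2).automorphicQuotient) [(quasiSplit F E c 2).IsAutomorphicMeasure μ]
    (νG : Measure (quasiSplit F E c 2).Adelic) [νG.IsHaarMeasure] [νG.IsInvInvariant]
    (μK : Measure ((standardMaximalCompactGL 2 E).comap (adelicVal F E c 2 ((StdForm.antidiagonal 2).over E)) : Subgroup (quasiSplit F E c 2).Adelic))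
    [μK.IsHaarMeasure]
    (νI : Measure (AdeleRing (𝓞 E) E)ˣ) [νI.IsHaarMeasure]
    (hBK : ∀ g : (quasiSplit F E c 2).Adelic, ∃ b ∈ borelAdelic F E c 2, ∃ k : (quasiSplit F E c 2).Adelic,
      adelicVal F E c 2 ((StdForm.antidiagonal 2).over E) k ∈ standardMaximalCompactGL 2 E ∧ g = b * k)
    {𝓕I : Set (AdeleRing (𝓞 E) E)ˣ} (h𝓕I : IsIdeleClassDomain E 𝓕I)
    (ν : Measure ↥(adelicUnipotent F E c 2)) [ν.IsHaarMeasure] [ν.IsInvInvariant]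
    {𝓕 : Set ↥(adelicUnipotent F E c 2)} (h𝓕N : IsFundamentalDomain ↥(rationalUnipotent F E c 2) 𝓕 ν) (h𝓕₀ : ν 𝓕 ≠ 0) (h𝓕top : ν 𝓕 ≠ ∞) :
    ∃ cμ K : ℝ, 0 < cμ ∧ 0 < K ∧
      ∀ {β : (quasiSplit F E c 2).Adelic → ℝ≥0∞}, IsCoveringWeight ((arithmeticBorel F E c 2).map (quasiSplit F E c 2).arithmeticSubgroup.subtype) β →
      ∀ {T : ℝ≥0}, 1 ≤ T →
      -- the four COEFFICIENTS `φ, φ′` (sections) and `φ̃, φ̃′` (intertwined sections): Borel, left-`N(𝔸)`∕`B(F)`-invariant, bounded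
      ∀ {φ φ' φt φt' : (quasiSplit F E c 2).Adelic → ℂ},
      Measurable φ →
        (∀ (n : unipotentInBorel F E c 2) (y : (quasiSplit F E c 2).Adelic), φ (((n : borelAdelic F E c 2) : (quasiSplit F E c 2).Adelic) * y) = φ y) →
        (∀ b ∈ arithmeticBorel F E c 2, ∀ y : (quasiSplit F E c 2).Adelic, φ ((b : (quasiSplit F E c 2).Adelic) * y) = φ y) →
      ∀ {Cφ : ℝ}, (∀ x, ‖φ x‖ ≤ Cφ) →
      Measurable φ' →
        (∀ (n : unipotentInBorel F E c 2) (y : (quasiSplit F E c 2).Adelic), φ' (((n : borelAdelic F E c 2) : (quasiSplit F E c 2).Adelic) * y) = φ' y) →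
        (∀ b ∈ arithmeticBorel F E c 2, ∀ y : (quasiSplit F E c 2).Adelic, φ' ((b : (quasiSplit F E c 2).Adelic) * y) = φ' y) →
      ∀ {Cφ' : ℝ}, (∀ x, ‖φ' x‖ ≤ Cφ') →
      Measurable φt →
        (∀ (n : unipotentInBorel F E c 2) (y : (quasiSplit F E c 2).Adelic), φt (((n : borelAdelic F E c 2) : (quasiSplit F E c 2).Adelic) * y) = φt y) →
        (∀ b ∈ arithmeticBorel F E c 2, ∀ y : (quasiSplit F E c 2).Adelic, φt ((b : (quasiSplit F E c 2).Adelic) * y) = φt y) →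
      ∀ {Cφt : ℝ}, (∀ x, ‖φt x‖ ≤ Cφt) →
      Measurable φt' →
        (∀ (n : unipotentInBorel F E c 2) (y : (quasiSplit F E c 2).Adelic), φt' (((n : borelAdelic F E c 2) : (quasiSplit F E c 2).Adelic) * y) = φt' y) →
        (∀ b ∈ arithmeticBorel F E c 2, ∀ y : (quasiSplit F E c 2).Adelic, φt' ((b : (quasiSplit F E c 2).Adelic) * y) = φt' y) →
      ∀ {Cφt' : ℝ}, (∀ x, ‖φt' x‖ ≤ Cφt') →
      -- the four idele-class weights `Ξ₁…Ξ₄` = torus∕`K_U`-averages of the coefficient pairs, ORIGINAL convention (★ p857588 decides them per character)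
      ∀ {Ξ₁ Ξ₂ Ξ₃ Ξ₄ : (AdeleRing (𝓞 E) E)ˣ → ℂ},
      Measurable Ξ₁ → ∀ {CΞ₁ : ℝ}, (∀ x, ‖Ξ₁ x‖ ≤ CΞ₁) → (∀ k ∈ GaloisRepresentations.principalIdeles E, ∀ x, Ξ₁ (k * x) = Ξ₁ x) →
        (∀ (r : ℝ≥0ˣ) (x : (AdeleRing (𝓞 E) E)ˣ), Ξ₁ (posRealIdele E r * x) = Ξ₁ x) →
        (∀ t : torusInBorel F E c 2,
          ∫ k, φ (((t : borelAdelic F E c 2) : (quasiSplit F E c 2).Adelic) * (k : (quasiSplit F E c 2).Adelic)) *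
              conj (φ' (((t : borelAdelic F E c 2) : (quasiSplit F E c 2).Adelic) * (k : (quasiSplit F E c 2).Adelic))) ∂μK = Ξ₁ (diagUnit (t : borelAdelic F E c 2).2 0)) →
      Measurable Ξ₂ → ∀ {CΞ₂ : ℝ}, (∀ x, ‖Ξ₂ x‖ ≤ CΞ₂) → (∀ k ∈ GaloisRepresentations.principalIdeles E, ∀ x, Ξ₂ (k * x) = Ξ₂ x) →
        (∀ (r : ℝ≥0ˣ) (x : (AdeleRing (𝓞 E) E)ˣ), Ξ₂ (posRealIdele E r * x) = Ξ₂ x) →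
        (∀ t : torusInBorel F E c 2,
          ∫ k, φ (((t : borelAdelic F E c 2) : (quasiSplit F E c 2).Adelic) * (k : (quasiSplit F E c 2).Adelic)) *
              conj (φt' (((t : borelAdelic F E c 2) : (quasiSplit F E c 2).Adelic) * (k : (quasiSplit F E c 2).Adelic))) ∂μK = Ξ₂ (diagUnit (t : borelAdelic F E c 2).2 0)) →
      Measurable Ξ₃ → ∀ {CΞ₃ : ℝ}, (∀ x, ‖Ξ₃ x‖ ≤ CΞ₃) → (∀ k ∈ GaloisRepresentations.principalIdeles E, ∀ x, Ξ₃ (k * x) = Ξ₃ x) →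
        (∀ (r : ℝ≥0ˣ) (x : (AdeleRing (𝓞 E) E)ˣ), Ξ₃ (posRealIdele E r * x) = Ξ₃ x) →
        (∀ t : torusInBorel F E c 2,
          ∫ k, φt (((t : borelAdelic F E c 2) : (quasiSplit F E c 2).Adelic) * (k : (quasiSplit F E c 2).Adelic)) *
              conj (φ' (((t : borelAdelic F E c 2) : (quasiSplit F E c 2).Adelic) * (k : (quasiSplit F E c 2).Adelic))) ∂μK = Ξ₃ (diagUnit (t : borelAdelic F E c 2).2 0)) →
      Measurable Ξ₄ → ∀ {CΞ₄ : ℝ}, (∀ x, ‖Ξ₄ x‖ ≤ CΞ₄) → (∀ k ∈ GaloisRepresentations.principalIdeles E, ∀ x, Ξ₄ (k * x) = Ξ₄ x) →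
        (∀ (r : ℝ≥0ˣ) (x : (AdeleRing (𝓞 E) E)ˣ), Ξ₄ (posRealIdele E r * x) = Ξ₄ x) →
        (∀ t : torusInBorel F E c 2,
          ∫ k, φt (((t : borelAdelic F E c 2) : (quasiSplit F E c 2).Adelic) * (k : (quasiSplit F E c 2).Adelic)) *
              conj (φt' (((t : borelAdelic F E c 2) : (quasiSplit F E c 2).Adelic) * (k : (quasiSplit F E c 2).Adelic))) ∂μK = Ξ₄ (diagUnit (t : borelAdelic F E c 2).2 0)) →
      ∀ {z z' : ℂ},
      -- (A) THE SUB-TUBE `1 < Re z′ < Re z`: ★ `_adj`'s named inputs with `Λ′ := Λ^T E(φ′, z′)`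
      (1 < z'.re → z'.re < z.re →
        (∀ x : (quasiSplit F E c 2).Adelic, T < borelHeight x → borelConstantTerm ν 𝓕 (eisensteinSeriesU (flatSectionU φ z)) x = flatSectionU φ z x + flatSectionU φt (1 - z) x) →
        (∀ g : (quasiSplit F E c 2).Adelic,
          Summable fun q : Quotient (orbitRel ↥(borelU (c : E →+* E) ((StdForm.antidiagonal 2).over E)) ↥(unitaryGroupOfForm (c : E →+* E) ((StdForm.antidiagonal 2).over E))) =>
            flatSectionU φ z ((quasiSplit F E c 2).toAdelic (q.out : ↥(unitaryGroupOfForm (c : E →+* E) ((StdForm.antidiagonal 2).over E))) * g)) →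
        Measurable (truncation ν 𝓕 T (eisensteinSeriesU (flatSectionU φ' z'))) →
        (∀ (γ : (quasiSplit F E c 2).arithmeticSubgroup) (x : (quasiSplit F E c 2).Adelic), truncation ν 𝓕 T (eisensteinSeriesU (flatSectionU φ' z')) ((γ : (quasiSplit F E c 2).Adelic) * x) = truncation ν 𝓕 T (eisensteinSeriesU (flatSectionU φ' z')) x) →
        ∀ {M₁ : ℝ}, (∀ g, ‖truncation ν 𝓕 T (eisensteinSeriesU (flatSectionU φ' z')) g‖ ≤ M₁) →
        ∫⁻ g, β g * ‖({y : (quasiSplit F E c 2).Adelic | borelHeight y ≤ T}.indicator (flatSectionU φ z) g - {y : (quasiSplit F E c 2).Adelic | T < borelHeight y}.indicator (flatSectionU φt (1 - z)) g)‖ₑ ∂νG < ∞ →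
        (∀ g, borelConstantTerm ν 𝓕 (truncation ν 𝓕 T (eisensteinSeriesU (flatSectionU φ' z'))) g = {y : (quasiSplit F E c 2).Adelic | borelHeight y ≤ T}.indicator (flatSectionU φ' z' + flatSectionU φt' (1 - z')) g - (∫ u : ↥(adelicUnipotent F E c 2), {y : (quasiSplit F E c 2).Adelic | T < borelHeight y}.indicator (flatSectionU φ' z' + flatSectionU φt' (1 - z')) ((quasiSplit F E c 2).toAdelic (weylLongU (c : E →+* E) (rfl : (StdForm.antidiagonal 2).over E = (StdForm.antidiagonal 2).over E)) * ((u : (quasiSplit F E c 2).Adelic) * g)) ∂ν)) →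
        (∀ g, T < borelHeight g → (∫ u : ↥(adelicUnipotent F E c 2), ({y : (quasiSplit F E c 2).Adelic | borelHeight y ≤ T}.indicator (flatSectionU φ z) (((quasiSplit F E c 2).toAdelic (weylLongU (c : E →+* E) (rfl : (StdForm.antidiagonal 2).over E = (StdForm.antidiagonal 2).over E)))⁻¹ * ((u : (quasiSplit F E c 2).Adelic) * g)) - {y : (quasiSplit F E c 2).Adelic | T < borelHeight y}.indicator (flatSectionU φt (1 - z)) (((quasiSplit F E c 2).toAdelic (weylLongU (c : E →+* E) (rfl : (StdForm.antidiagonal 2).over E = (StdForm.antidiagonal 2).over E)))⁻¹ * ((u : (quasiSplit F E c 2).Adelic) * g))) ∂ν) = flatSectionU φt (1 - z) g) →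
        Integrable (fun g => (β g).toReal • (({y : (quasiSplit F E c 2).Adelic | borelHeight y ≤ T}.indicator (flatSectionU φ z) g - {y : (quasiSplit F E c 2).Adelic | T < borelHeight y}.indicator (flatSectionU φt (1 - z)) g) * conj (∫ u : ↥(adelicUnipotent F E c 2), {y : (quasiSplit F E c 2).Adelic | T < borelHeight y}.indicator (flatSectionU φ' z' + flatSectionU φt' (1 - z')) ((quasiSplit F E c 2).toAdelic (weylLongU (c : E →+* E) (rfl : (StdForm.antidiagonal 2).over E = (StdForm.antidiagonal 2).over E)) * ((u : (quasiSplit F E c 2).Adelic) * g)) ∂ν))) νG →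
        ∫⁻ g, β g * ∫⁻ u : ↥(adelicUnipotent F E c 2), ‖{y : (quasiSplit F E c 2).Adelic | T < borelHeight y}.indicator (flatSectionU φ' z' + flatSectionU φt' (1 - z')) ((quasiSplit F E c 2).toAdelic (weylLongU (c : E →+* E) (rfl : (StdForm.antidiagonal 2).over E = (StdForm.antidiagonal 2).over E)) * ((u : (quasiSplit F E c 2).Adelic) * g)) * conj ({y : (quasiSplit F E c 2).Adelic | borelHeight y ≤ T}.indicator (flatSectionU φ z) g - {y : (quasiSplit F E c 2).Adelic | T < borelHeight y}.indicator (flatSectionU φt (1 - z)) g)‖ₑ ∂ν ∂νG < ∞ →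
        ∫⁻ g, β g * ∫⁻ u : ↥(adelicUnipotent F E c 2), ‖{y : (quasiSplit F E c 2).Adelic | T < borelHeight y}.indicator (flatSectionU φ' z' + flatSectionU φt' (1 - z')) g * conj ({y : (quasiSplit F E c 2).Adelic | borelHeight y ≤ T}.indicator (flatSectionU φ z) (((quasiSplit F E c 2).toAdelic (weylLongU (c : E →+* E) (rfl : (StdForm.antidiagonal 2).over E = (StdForm.antidiagonal 2).over E)))⁻¹ * ((u : (quasiSplit F E c 2).Adelic) * g)) - {y : (quasiSplit F E c 2).Adelic | T < borelHeight y}.indicator (flatSectionU φt (1 - z)) (((quasiSplit F E c 2).toAdelic (weylLongU (c : E →+* E) (rfl : (StdForm.antidiagonal 2).over E = (StdForm.antidiagonal 2).over E)))⁻¹ * ((u : (quasiSplit F E c 2).Adelic) * g)))‖ₑ ∂ν ∂νG < ∞ →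
        ∫ x, (quasiSplit F E c 2).quotFun (truncation ν 𝓕 T (eisensteinSeriesU (flatSectionU φ z))) x * conj ((quasiSplit F E c 2).quotFun (truncation ν 𝓕 T (eisensteinSeriesU (flatSectionU φ' z'))) x) ∂μ =
          (cμ : ℂ) * ((K : ℂ) *
            ((((T : ℝ) : ℂ) ^ (z + conj z' - 1) / (z + conj z' - 1)) * (∫ x in {x : (AdeleRing (𝓞 E) E)ˣ | (IdeleClassGroup.ideleNorm E x : ℝ) ≤ 1} ∩ 𝓕I, ((IdeleClassGroup.ideleNorm E x : ℝ) : ℂ) * Ξ₁ x ∂νI)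
              + (((T : ℝ) : ℂ) ^ (z - conj z') / (z - conj z')) * (∫ x in {x : (AdeleRing (𝓞 E) E)ˣ | (IdeleClassGroup.ideleNorm E x : ℝ) ≤ 1} ∩ 𝓕I, ((IdeleClassGroup.ideleNorm E x : ℝ) : ℂ) * Ξ₂ x ∂νI)
              - (((T : ℝ) : ℂ) ^ (-(z - conj z')) / (z - conj z')) * (∫ x in {x : (AdeleRing (𝓞 E) E)ˣ | (IdeleClassGroup.ideleNorm E x : ℝ) ≤ 1} ∩ 𝓕I, ((IdeleClassGroup.ideleNorm E x : ℝ) : ℂ) * Ξ₃ x ∂νI)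
              - (((T : ℝ) : ℂ) ^ (-(z + conj z' - 1)) / (z + conj z' - 1)) * (∫ x in {x : (AdeleRing (𝓞 E) E)ˣ | (IdeleClassGroup.ideleNorm E x : ℝ) ≤ 1} ∩ 𝓕I, ((IdeleClassGroup.ideleNorm E x : ℝ) : ℂ) * Ξ₄ x ∂νI)))) ∧
      -- (B) THE MIRROR SUB-TUBE `1 < Re z < Re z′`: the same named inputs for the SWAPPED pair (`Λ := Λ^T E(φ, z)` Borel∕`G(F)`-invariant∕bounded, `ψ′ := 𝟙_{H≤T} f′_{z′} − 𝟙_{T<H} φ̃′_{1−z′}`)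
      (1 < z.re → z.re < z'.re →
        (∀ x : (quasiSplit F E c 2).Adelic, T < borelHeight x → borelConstantTerm ν 𝓕 (eisensteinSeriesU (flatSectionU φ' z')) x = flatSectionU φ' z' x + flatSectionU φt' (1 - z') x) →
        (∀ g : (quasiSplit F E c 2).Adelic,
          Summable fun q : Quotient (orbitRel ↥(borelU (c : E →+* E) ((StdForm.antidiagonal 2).over E)) ↥(unitaryGroupOfForm (c : E →+* E) ((StdForm.antidiagonal 2).over E))) =>
            flatSectionU φ' z' ((quasiSplit F E c 2).toAdelic (q.out : ↥(unitaryGroupOfForm (c : E →+* E) ((StdForm.antidiagonal 2).over E))) * g)) →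
        Measurable (truncation ν 𝓕 T (eisensteinSeriesU (flatSectionU φ z))) →
        (∀ (γ : (quasiSplit F E c 2).arithmeticSubgroup) (x : (quasiSplit F E c 2).Adelic), truncation ν 𝓕 T (eisensteinSeriesU (flatSectionU φ z)) ((γ : (quasiSplit F E c 2).Adelic) * x) = truncation ν 𝓕 T (eisensteinSeriesU (flatSectionU φ z)) x) →
        ∀ {M₁ : ℝ}, (∀ g, ‖truncation ν 𝓕 T (eisensteinSeriesU (flatSectionU φ z)) g‖ ≤ M₁) →
        ∫⁻ g, β g * ‖({y : (quasiSplit F E c 2).Adelic | borelHeight y ≤ T}.indicator (flatSectionU φ' z') g - {y : (quasiSplit F E c 2).Adelic | T < borelHeight y}.indicator (flatSectionU φt' (1 - z')) g)‖ₑ ∂νG < ∞ →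
        (∀ g, borelConstantTerm ν 𝓕 (truncation ν 𝓕 T (eisensteinSeriesU (flatSectionU φ z))) g = {y : (quasiSplit F E c 2).Adelic | borelHeight y ≤ T}.indicator (flatSectionU φ z + flatSectionU φt (1 - z)) g - (∫ u : ↥(adelicUnipotent F E c 2), {y : (quasiSplit F E c 2).Adelic | T < borelHeight y}.indicator (flatSectionU φ z + flatSectionU φt (1 - z)) ((quasiSplit F E c 2).toAdelic (weylLongU (c : E →+* E) (rfl : (StdForm.antidiagonal 2).over E = (StdForm.antidiagonal 2).over E)) * ((u : (quasiSplit F E c 2).Adelic) * g)) ∂ν)) →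
        (∀ g, T < borelHeight g → (∫ u : ↥(adelicUnipotent F E c 2), ({y : (quasiSplit F E c 2).Adelic | borelHeight y ≤ T}.indicator (flatSectionU φ' z') (((quasiSplit F E c 2).toAdelic (weylLongU (c : E →+* E) (rfl : (StdForm.antidiagonal 2).over E = (StdForm.antidiagonal 2).over E)))⁻¹ * ((u : (quasiSplit F E c 2).Adelic) * g)) - {y : (quasiSplit F E c 2).Adelic | T < borelHeight y}.indicator (flatSectionU φt' (1 - z')) (((quasiSplit F E c 2).toAdelic (weylLongU (c : E →+* E) (rfl : (StdForm.antidiagonal 2).over E = (StdForm.antidiagonal 2).over E)))⁻¹ * ((u : (quasiSplit F E c 2).Adelic) * g))) ∂ν) = flatSectionU φt' (1 - z') g) →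
        Integrable (fun g => (β g).toReal • (({y : (quasiSplit F E c 2).Adelic | borelHeight y ≤ T}.indicator (flatSectionU φ' z') g - {y : (quasiSplit F E c 2).Adelic | T < borelHeight y}.indicator (flatSectionU φt' (1 - z')) g) * conj (∫ u : ↥(adelicUnipotent F E c 2), {y : (quasiSplit F E c 2).Adelic | T < borelHeight y}.indicator (flatSectionU φ z + flatSectionU φt (1 - z)) ((quasiSplit F E c 2).toAdelic (weylLongU (c : E →+* E) (rfl : (StdForm.antidiagonal 2).over E = (StdForm.antidiagonal 2).over E)) * ((u : (quasiSplit F E c 2).Adelic) * g)) ∂ν))) νG →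
        ∫⁻ g, β g * ∫⁻ u : ↥(adelicUnipotent F E c 2), ‖{y : (quasiSplit F E c 2).Adelic | T < borelHeight y}.indicator (flatSectionU φ z + flatSectionU φt (1 - z)) ((quasiSplit F E c 2).toAdelic (weylLongU (c : E →+* E) (rfl : (StdForm.antidiagonal 2).over E = (StdForm.antidiagonal 2).over E)) * ((u : (quasiSplit F E c 2).Adelic) * g)) * conj ({y : (quasiSplit F E c 2).Adelic | borelHeight y ≤ T}.indicator (flatSectionU φ' z') g - {y : (quasiSplit F E c 2).Adelic | T < borelHeight y}.indicator (flatSectionU φt' (1 - z')) g)‖ₑ ∂ν ∂νG < ∞ →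
        ∫⁻ g, β g * ∫⁻ u : ↥(adelicUnipotent F E c 2), ‖{y : (quasiSplit F E c 2).Adelic | T < borelHeight y}.indicator (flatSectionU φ z + flatSectionU φt (1 - z)) g * conj ({y : (quasiSplit F E c 2).Adelic | borelHeight y ≤ T}.indicator (flatSectionU φ' z') (((quasiSplit F E c 2).toAdelic (weylLongU (c : E →+* E) (rfl : (StdForm.antidiagonal 2).over E = (StdForm.antidiagonal 2).over E)))⁻¹ * ((u : (quasiSplit F E c 2).Adelic) * g)) - {y : (quasiSplit F E c 2).Adelic | T < borelHeight y}.indicator (flatSectionU φt' (1 - z')) (((quasiSplit F E c 2).toAdelic (weylLongU (c : E →+* E) (rfl : (StdForm.antidiagonal 2).over E = (StdForm.antidiagonal 2).over E)))⁻¹ * ((u : (quasiSplit F E c 2).Adelic) * g)))‖ₑ ∂ν ∂νG < ∞ →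
        ∫ x, (quasiSplit F E c 2).quotFun (truncation ν 𝓕 T (eisensteinSeriesU (flatSectionU φ z))) x * conj ((quasiSplit F E c 2).quotFun (truncation ν 𝓕 T (eisensteinSeriesU (flatSectionU φ' z'))) x) ∂μ =
          (cμ : ℂ) * ((K : ℂ) *
            ((((T : ℝ) : ℂ) ^ (z + conj z' - 1) / (z + conj z' - 1)) * (∫ x in {x : (AdeleRing (𝓞 E) E)ˣ | (IdeleClassGroup.ideleNorm E x : ℝ) ≤ 1} ∩ 𝓕I, ((IdeleClassGroup.ideleNorm E x : ℝ) : ℂ) * Ξ₁ x ∂νI)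
              + (((T : ℝ) : ℂ) ^ (z - conj z') / (z - conj z')) * (∫ x in {x : (AdeleRing (𝓞 E) E)ˣ | (IdeleClassGroup.ideleNorm E x : ℝ) ≤ 1} ∩ 𝓕I, ((IdeleClassGroup.ideleNorm E x : ℝ) : ℂ) * Ξ₂ x ∂νI)
              - (((T : ℝ) : ℂ) ^ (-(z - conj z')) / (z - conj z')) * (∫ x in {x : (AdeleRing (𝓞 E) E)ˣ | (IdeleClassGroup.ideleNorm E x : ℝ) ≤ 1} ∩ 𝓕I, ((IdeleClassGroup.ideleNorm E x : ℝ) : ℂ) * Ξ₃ x ∂νI)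
              - (((T : ℝ) : ℂ) ^ (-(z + conj z' - 1)) / (z + conj z' - 1)) * (∫ x in {x : (AdeleRing (𝓞 E) E)ˣ | (IdeleClassGroup.ideleNorm E x : ℝ) ≤ 1} ∩ 𝓕I, ((IdeleClassGroup.ideleNorm E x : ℝ) : ℂ) * Ξ₄ x ∂νI)))) := by
  obtain ⟨cμ, K, hcμ, hK, hGen⟩ := maassSelberg_flatSectionU_two_adj hc hc1 μ νG μK νI hBK h𝓕I ν h𝓕N h𝓕₀ h𝓕top
  refine ⟨cμ, K, hcμ, hK, ?_⟩
  intro β hβ T hT φ φ' φt φt' hφm hφN hφB Cφ hφC hφ'm hφ'N hφ'B Cφ' hφ'C hφtm hφtN hφtB Cφt hφtC hφt'm hφt'N hφt'B Cφt' hφt'C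
    Ξ₁ Ξ₂ Ξ₃ Ξ₄ hΞ₁m CΞ₁ hΞ₁C hΞ₁K hΞ₁M hΞ₁ hΞ₂m CΞ₂ hΞ₂C hΞ₂K hΞ₂M hΞ₂ hΞ₃m CΞ₃ hΞ₃C hΞ₃K hΞ₃M hΞ₃ hΞ₄m CΞ₄ hΞ₄C hΞ₄K hΞ₄M hΞ₄ z z'
  refine ⟨?_, ?_⟩
  · -- (A): ★ `_adj` verbatim with `Λ′ := Λ^T E(φ′, z′)`
    intro hz' hzz' hCT hsum hΛm hΛG M₁ hΛbdd hψL1 hCT' hM'ψ hi₅ habs habs'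
    exact hGen hβ hT hφm hφN hφB hφC hφ'm hφ'N hφ'B hφ'C hφtm hφtN hφtB hφtC hφt'm hφt'N hφt'B hφt'C hz' hzz' hCT hsum hΛm hΛG hΛbdd hψL1
      hCT' hM'ψ hi₅ habs habs' hΞ₁m hΞ₁C hΞ₁K hΞ₁M hΞ₁ hΞ₂m hΞ₂C hΞ₂K hΞ₂M hΞ₂ hΞ₃m hΞ₃C hΞ₃K hΞ₃M hΞ₃ hΞ₄m hΞ₄C hΞ₄K hΞ₄M hΞ₄
  · -- (B): ★ `_adj` at the SWAPPED data `((φ′,z′,φ̃′),(φ,z,φ̃))`, `Λ′ := Λ^T E(φ, z)`, `Ξ′ := (conj Ξ₁, conj Ξ₃, conj Ξ₂, conj Ξ₄)`, then ★ §1 of the `U(J₃)` file + §1 here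
    intro hz hzz' hCT hsum hΛm hΛG M₁ hΛbdd hψL1 hCT' hM'ψ hi₅ habs habs'
    -- the swapped `K_U`-averages are the conjugates of the original ones
    have hcm : ∀ {Ξ : (AdeleRing (𝓞 E) E)ˣ → ℂ}, Measurable Ξ → Measurable fun x => conj (Ξ x) := fun hΞ => Complex.continuous_conj.measurable.comp hΞ
    have hcC : ∀ {Ξ : (AdeleRing (𝓞 E) E)ˣ → ℂ} {C : ℝ}, (∀ x, ‖Ξ x‖ ≤ C) → ∀ x, ‖conj (Ξ x)‖ ≤ C := fun hΞ x => by rw [Complex.norm_conj]; exact hΞ x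
    have hcK : ∀ {Ξ : (AdeleRing (𝓞 E) E)ˣ → ℂ}, (∀ k ∈ GaloisRepresentations.principalIdeles E, ∀ x, Ξ (k * x) = Ξ x) →
        ∀ k ∈ GaloisRepresentations.principalIdeles E, ∀ x, conj (Ξ (k * x)) = conj (Ξ x) := fun hΞ k hk x => by rw [hΞ k hk x]
    have hcM : ∀ {Ξ : (AdeleRing (𝓞 E) E)ˣ → ℂ}, (∀ (r : ℝ≥0ˣ) (x : (AdeleRing (𝓞 E) E)ˣ), Ξ (posRealIdele E r * x) = Ξ x) →
        ∀ (r : ℝ≥0ˣ) (x : (AdeleRing (𝓞 E) E)ˣ), conj (Ξ (posRealIdele E r * x)) = conj (Ξ x) := fun hΞ r x => by rw [hΞ r x]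
    have hcT : ∀ {Ξ : (AdeleRing (𝓞 E) E)ˣ → ℂ} {α α' : (quasiSplit F E c 2).Adelic → ℂ},
        (∀ t : torusInBorel F E c 2,
          ∫ k, α (((t : borelAdelic F E c 2) : (quasiSplit F E c 2).Adelic) * (k : (quasiSplit F E c 2).Adelic)) *
              conj (α' (((t : borelAdelic F E c 2) : (quasiSplit F E c 2).Adelic) * (k : (quasiSplit F E c 2).Adelic))) ∂μK = Ξ (diagUnit (t : borelAdelic F E c 2).2 0)) →
        ∀ t : torusInBorel F E c 2,
          ∫ k, α' (((t : borelAdelic F E c 2) : (quasiSplit F E c 2).Adelic) * (k : (quasiSplit F E c 2).Adelic)) *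
              conj (α (((t : borelAdelic F E c 2) : (quasiSplit F E c 2).Adelic) * (k : (quasiSplit F E c 2).Adelic))) ∂μK = conj (Ξ (diagUnit (t : borelAdelic F E c 2).2 0)) :=
      fun hΞ t => by rw [← hΞ t]; exact integral_mul_conj_symm μK _ _
    have key := hGen hβ hT hφ'm hφ'N hφ'B hφ'C hφm hφN hφB hφC hφt'm hφt'N hφt'B hφt'C hφtm hφtN hφtB hφtC hz hzz' hCT hsum hΛm hΛG hΛbdd hψL1
      hCT' hM'ψ hi₅ habs habs' (Ξ₁ := fun x => conj (Ξ₁ x)) (Ξ₂ := fun x => conj (Ξ₃ x)) (Ξ₃ := fun x => conj (Ξ₂ x)) (Ξ₄ := fun x => conj (Ξ₄ x))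
      (hcm hΞ₁m) (hcC hΞ₁C) (hcK hΞ₁K) (hcM hΞ₁M) (hcT hΞ₁) (hcm hΞ₃m) (hcC hΞ₃C) (hcK hΞ₃K) (hcM hΞ₃M) (hcT hΞ₃)
      (hcm hΞ₂m) (hcC hΞ₂C) (hcK hΞ₂K) (hcM hΞ₂M) (hcT hΞ₂) (hcm hΞ₄m) (hcC hΞ₄C) (hcK hΞ₄K) (hcM hΞ₄M) (hcT hΞ₄)
    have hT0 : (0 : ℝ) ≤ (T : ℝ) := T.coe_nonneg
    have key₂ := maassSelberg_transport_of_swap_one μ hT0 key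
    -- the conjugated brackets conjugate back
    have hbr : ∀ Ξ : (AdeleRing (𝓞 E) E)ˣ → ℂ,
        conj (∫ x in {x : (AdeleRing (𝓞 E) E)ˣ | (IdeleClassGroup.ideleNorm E x : ℝ) ≤ 1} ∩ 𝓕I, ((IdeleClassGroup.ideleNorm E x : ℝ) : ℂ) * conj (Ξ x) ∂νI) =
          ∫ x in {x : (AdeleRing (𝓞 E) E)ˣ | (IdeleClassGroup.ideleNorm E x : ℝ) ≤ 1} ∩ 𝓕I, ((IdeleClassGroup.ideleNorm E x : ℝ) : ℂ) * Ξ x ∂νI := fun Ξ => by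
      rw [conj_setIntegral_ofReal_mul]; simp only [Complex.conj_conj]
    rw [hbr Ξ₁, hbr Ξ₂, hbr Ξ₃, hbr Ξ₄] at key₂
    exact key₂

end Pair

end Summit.HodgeConjecture.HodgeConjecture.Cruxes.H413.K2E1MaassSelbergSymmetryTwo

end
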